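import Literature.AlgebraicGeometry.Frobenioids.TwoLevelFrobenioid
import Literature.AlgebraicGeometry.Frobenioids.Frobenioid
import HarnessLib

/-!
# The two-level Frobenioid over `B(ℤ/2)`: types of morphisms and objects

Mochizuki, *The geometry of Frobenioids I: the general theory*, Kyushu J. Math. **62** (2008)
293–400, §1, Definition 1.2 pp. 21–23 [cite: MochizukiFrdI2008, Def. 1.2 p.21] — applied to OUR
two-object test category `C` of `TwoLevelFrobenioid.lean` (finding F-t8g2-1 of the abc-iut cell; not
a construction of the paper).

Classification (all proved): every arrow is a base-isomorphism (the base is a groupoid); linear =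
degree `1`; isometric = divisor `0`; pre-steps = linear arrows; the co-angular arrows are exactly the
arrows that are NOT linear arrows `low → top` (those factor through the non-invertible isometric
pre-step `h = (1, 0, 1) : low → top`); co-angular pre-steps = linear endomorphisms; morphisms of
Frobenius type = isometric arrows other than the linear `low → top` ones; pull-back morphisms =
isomorphisms; `top` is Frobenius-trivial and isotropic, `low` is NOT isotropic (its hull is `h`),
is metrically trivial, and is NOT `Aut`-ample.  Nothing here bears on [IUTchIII].
-/

namespace Literature.AlgebraicGeometry.Frobenioids

open CategoryTheory Opposite

namespace TwoLevel

open PreFrobenioid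

/-! ### Linear, isometric, base-iso, pre-step -/

/-- Every arrow of the base `B(ℤ/2)` is invertible. [cite: MochizukiFrdI2008, Def. 1.2(ii) p.21] -/
theorem isIso_base {A B : D} (f : A ⟶ B) : IsIso f := IsIso.of_groupoid f

/-- Every arrow of `C` is a base-isomorphism. [cite: MochizukiFrdI2008, Def. 1.2(ii) p.21] -/
theorem isBaseIso {A B : Obj} (f : A ⟶ B) : IsBaseIso toElem f := isIso_base _

/-- Linear = degree `1`. [cite: MochizukiFrdI2008, Def. 1.2(i) p.21] -/
theorem isLinear_iff {A B : Obj} (f : A ⟶ B) : IsLinear toElem f ↔ dg f.1 = 1 := Iff.rfl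

/-- Isometric = divisor `0`. [cite: MochizukiFrdI2008, Def. 1.2(i) p.21] -/
theorem isIsometry_iff {A B : Obj} (f : A ⟶ B) : IsIsometry toElem f ↔ dv f.1 = 1 := Iff.rfl

/-- Pre-steps = linear arrows. [cite: MochizukiFrdI2008, Def. 1.2(iii) p.22] -/
theorem isPreStep_iff {A B : Obj} (f : A ⟶ B) : IsPreStep toElem f ↔ dg f.1 = 1 :=
  ⟨fun h => h.1, fun h => ⟨h, isBaseIso f⟩⟩

/-- Arrows `low → low` are pre-steps. [cite: MochizukiFrdI2008, Def. 1.2(iii) p.22] -/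
theorem isPreStep_low (f : Obj.low ⟶ Obj.low) : IsPreStep toElem f := (isPreStep_iff f).mpr (dg_low f)

/-- Base-identity = base component `1`. [cite: MochizukiFrdI2008, Def. 1.2(ii) p.21] -/
theorem isBaseIdentity_iff {A : Obj} (f : A ⟶ A) : IsBaseIdentity toElem f ↔ bs f.1 = 1 := Iff.rfl

/-! ### The isometric pre-step `h : low → top` -/

/-- The arrow `h_g = (g, 0, 1) : low → top`. [cite: MochizukiFrdI2008, Def. 1.2(iv) p.23] -/
def hHom (g : X) : Obj.low ⟶ Obj.top := toTop Obj.low g 1 1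

/-- `h_g` is an isometric pre-step. [cite: MochizukiFrdI2008, Def. 1.2(iii) p.22] -/
theorem hHom_isIsometry_isPreStep (g : X) : IsIsometry toElem (hHom g) ∧ IsPreStep toElem (hHom g) :=
  ⟨rfl, (isPreStep_iff _).mpr rfl⟩

/-- A linear arrow `low → top` factors as `h₁ ≫ (same triple on top)`. [cite: MochizukiFrdI2008, Def. 1.2(iii) p.22] -/
theorem factor_low_top (f : Obj.low ⟶ Obj.top) :
    𝟙 Obj.low ≫ hHom 1 ≫ toTop Obj.top (bs f.1) (dv f.1) (dg f.1) = f := by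
  refine hom_ext (E_ext ?_ ?_ ?_) <;> simp [hHom]

/-! ### Co-angular arrows -/

/-- Endomorphisms of `low` are co-angular. [cite: MochizukiFrdI2008, Def. 1.2(iii) p.22] -/
theorem isCoAngular_low (f : Obj.low ⟶ Obj.low) : IsCoAngular toElem f := by
  intro X Y γ β α _ _ hβi hβp _
  cases Y
  · cases X
    · exact (isIso_iff β).mpr ⟨rfl, hβp.1, hβi⟩
    · exact (no_top_low β).elim
  · exact (no_top_low α).elim

/-- Endomorphisms of `top` are co-angular. [cite: MochizukiFrdI2008, Def. 1.2(iii) p.22] -/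
theorem isCoAngular_top (f : Obj.top ⟶ Obj.top) : IsCoAngular toElem f := by
  intro X Y γ β α _ _ hβi hβp _
  cases X
  · exact (no_top_low γ).elim
  · cases Y
    · exact (no_top_low β).elim
    · exact (isIso_iff β).mpr ⟨rfl, hβp.1, hβi⟩

/-- An arrow `low → top` of degree `≠ 1` is co-angular (degree count). [cite: MochizukiFrdI2008, Def. 1.2(iii) p.22] -/
theorem isCoAngular_low_top {f : Obj.low ⟶ Obj.top} (hf : dg f.1 ≠ 1) : IsCoAngular toElem f := by
  intro X Y γ β α h hα hβi hβp _
  have hdeg : dg γ.1 * dg β.1 * dg α.1 = dg f.1 := by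
    rw [← h]; simp [mul_assoc]
  have hα1 : dg α.1 = 1 := hα
  cases X <;> cases Y
  · have hβ1 : dg β.1 = 1 := hβp.1
    rw [dg_low γ, hβ1, hα1, one_mul, one_mul] at hdeg
    exact (hf hdeg.symm).elim
  · have hβ1 : dg β.1 = 1 := hβp.1
    rw [dg_low γ, hβ1, hα1, one_mul, one_mul] at hdeg
    exact (hf hdeg.symm).elim
  · exact (no_top_low β).elim
  · exact (isIso_iff β).mpr ⟨rfl, hβp.1, hβi⟩

/-- A LINEAR arrow `low → top` is NOT co-angular: it factors through the non-invertible isometric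
pre-step `h₁`. [cite: MochizukiFrdI2008, Def. 1.2(iii) p.22] -/
theorem not_isCoAngular_low_top {f : Obj.low ⟶ Obj.top} (hf : dg f.1 = 1) : ¬ IsCoAngular toElem f := by
  intro h
  have := h (𝟙 Obj.low) (hHom 1) (toTop Obj.top (bs f.1) (dv f.1) (dg f.1)) (factor_low_top f)
    hf (hHom_isIsometry_isPreStep 1).1 (hHom_isIsometry_isPreStep 1).2 (Or.inl (isBaseIso _))
  exact not_isIso_low_top _ this

/-- Co-angularity classified: all arrows except the linear `low → top` ones. [cite: MochizukiFrdI2008, Def. 1.2(iii) p.22] -/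
theorem isCoAngular_iff {A B : Obj} (f : A ⟶ B) :
    IsCoAngular toElem f ↔ ¬ (A = Obj.low ∧ B = Obj.top ∧ dg f.1 = 1) := by
  cases A <;> cases B
  · exact ⟨fun _ ⟨_, h, _⟩ => Obj.noConfusion h, fun _ => isCoAngular_low f⟩
  · refine ⟨fun h ⟨_, _, h1⟩ => not_isCoAngular_low_top h1 h, fun h => isCoAngular_low_top ?_⟩
    exact fun h1 => h ⟨rfl, rfl, h1⟩
  · exact (no_top_low f).elim
  · exact ⟨fun _ ⟨h, _⟩ => Obj.noConfusion h, fun _ => isCoAngular_top f⟩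

/-- Co-angular pre-steps are exactly the linear endomorphisms. [cite: MochizukiFrdI2008, Def. 1.3(iii) p.24] -/
theorem isCoAngularPreStep_iff {A B : Obj} (f : A ⟶ B) :
    IsCoAngularPreStep toElem f ↔ A = B ∧ dg f.1 = 1 := by
  rw [IsCoAngularPreStep, isCoAngular_iff, isPreStep_iff]
  cases A <;> cases B
  · simp
  · simp
  · exact (no_top_low f).elim
  · simp

/-- Every endomorphism of `low` is a co-angular pre-step. [cite: MochizukiFrdI2008, Def. 1.3(iii) p.24] -/
theorem isCoAngularPreStep_low (f : Obj.low ⟶ Obj.low) : IsCoAngularPreStep toElem f :=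
  (isCoAngularPreStep_iff f).mpr ⟨rfl, dg_low f⟩

/-- A linear endomorphism of `top` is a co-angular pre-step. [cite: MochizukiFrdI2008, Def. 1.3(iii) p.24] -/
theorem isCoAngularPreStep_top {f : Obj.top ⟶ Obj.top} (h : dg f.1 = 1) : IsCoAngularPreStep toElem f :=
  (isCoAngularPreStep_iff f).mpr ⟨rfl, h⟩

/-- Morphisms of Frobenius type: isometric and co-angular (base-iso is automatic).
[cite: MochizukiFrdI2008, Def. 1.2(iii) p.22] -/
theorem isFrobeniusType_iff {A B : Obj} (f : A ⟶ B) :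
    IsFrobeniusType toElem f ↔ dv f.1 = 1 ∧ ¬ (A = Obj.low ∧ B = Obj.top ∧ dg f.1 = 1) := by
  rw [IsFrobeniusType, IsLBInvertible, isCoAngular_iff, isIsometry_iff]
  exact ⟨fun h => ⟨h.1.2, h.1.1⟩, fun h => ⟨⟨h.2, h.1⟩, isBaseIso f⟩⟩

/-- The Frobenius arrow `(g, 0, n) : A → top` is of Frobenius type when `n ≠ 1` or `A = top`.
[cite: MochizukiFrdI2008, Def. 1.2(iii) p.22] -/
theorem isFrobeniusType_toTop {A : Obj} (g : X) (n : ℕ+) (h : A = Obj.top ∨ n ≠ 1) :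
    IsFrobeniusType toElem (toTop A g 1 n) := by
  refine (isFrobeniusType_iff _).mpr ⟨rfl, fun ⟨h1, _, h3⟩ => ?_⟩
  rcases h with h | h
  · exact Obj.noConfusion (h1.symm.trans h)
  · exact h h3

/-! ### Pull-back morphisms = isomorphisms -/

/-- In `ℤ_{≥0}` a product is `1` only if the left factor is. [cite: MochizukiFrdI2008, §0 p.11] -/
theorem eq_one_of_mul_eq_one_left_M {a b : M} (h : a * b = 1) : a = 1 :=
  eq_one_of_mul_eq_one_M (by rwa [mul_comm] at h)

/-- The pull-back morphisms of `C` are exactly its isomorphisms. [cite: MochizukiFrdI2008, Def. 1.2(ii) p.21] -/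
theorem isPullbackMorphism_iff {A B : Obj} (f : A ⟶ B) : IsPullbackMorphism toElem f ↔ IsIso f := by
  refine ⟨fun h => ?_, fun _ => isPullbackMorphism_of_isIso toElem f⟩
  rw [isIso_iff]
  cases A <;> cases B
  · -- `low → low`: surjectivity at the pair `(𝟙, (bs f)⁻¹)` forces `dv f = 1`
    obtain ⟨γ, hγ⟩ := (h Obj.low).2 ⟨(𝟙 _, ((bs f.1)⁻¹ : X)), by
      show bs (𝟙 E) = bs f.1 * (bs f.1)⁻¹; rw [bs_id, mul_inv_cancel]⟩
    have h1 : γ ≫ f = 𝟙 _ := congrArg (fun p : PullbackHomData toElem f Obj.low => p.1.1) hγ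
    have h2 : dv (γ.1 ≫ f.1) = 1 := by rw [← comp_val, h1, id_val, dv_id]
    rw [dv_comp, dg_low f, PNat.one_coe, pow_one] at h2
    exact ⟨rfl, dg_low f, eq_one_of_mul_eq_one_left_M h2⟩
  · -- `low → top`: the pair `((g, z, 2n), 1)` has no preimage since arrows out of `low` into `low` are linear
    exfalso
    obtain ⟨γ, hγ⟩ := (h Obj.low).2 ⟨(toTop Obj.low (bs f.1) (dv f.1) (dg f.1 * 2), (1 : X)), by
      show bs f.1 = bs f.1 * 1; rw [mul_one]⟩
    have h1 : γ ≫ f = toTop Obj.low (bs f.1) (dv f.1) (dg f.1 * 2) :=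
      congrArg (fun p : PullbackHomData toElem f Obj.low => p.1.1) hγ
    have h2 : dg (γ.1 ≫ f.1) = dg f.1 * 2 := by rw [← comp_val, h1, toTop_val, dg_tr]
    rw [dg_comp, dg_low γ, one_mul] at h2
    have h3 : (dg f.1 : ℕ) * 1 = dg f.1 * 2 := by rw [mul_one]; exact_mod_cast h2
    exact absurd (Nat.eq_of_mul_eq_mul_left (PNat.pos _) h3) (by decide)
  · exact (no_top_low f).elim
  · -- `top → top`: surjectivity at `(𝟙, (bs f)⁻¹)` forces `dg f = 1`, `dv f = 1`
    obtain ⟨γ, hγ⟩ := (h Obj.top).2 ⟨(𝟙 _, ((bs f.1)⁻¹ : X)), by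
      show bs (𝟙 E) = bs f.1 * (bs f.1)⁻¹; rw [bs_id, mul_inv_cancel]⟩
    have h1 : γ ≫ f = 𝟙 _ := congrArg (fun p : PullbackHomData toElem f Obj.top => p.1.1) hγ
    have hd : dg (γ.1 ≫ f.1) = 1 := by rw [← comp_val, h1, id_val, dg_id]
    rw [dg_comp] at hd
    have hdf : dg f.1 = 1 := pnat_eq_one_of_mul_eq_one (by rwa [mul_comm] at hd)
    have h2 : dv (γ.1 ≫ f.1) = 1 := by rw [← comp_val, h1, id_val, dv_id]
    rw [dv_comp, hdf, PNat.one_coe, pow_one] at h2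
    exact ⟨rfl, hdf, eq_one_of_mul_eq_one_left_M h2⟩

/-! ### Objects -/

/-- The Frobenius section `n ↦ (1, 0, n)` of `top`, as a monoid homomorphism into `End(top)`.
[cite: MochizukiFrdI2008, Def. 1.2(iv) p.22] -/
def frobTop : ℕ+ →* End Obj.top where
  toFun n := toTop Obj.top 1 1 n
  map_one' := hom_ext (E_ext rfl rfl rfl)
  map_mul' m n := hom_ext (E_ext (by simp [End.mul_def]) (by simp [End.mul_def]) (by
    show m * n = dg ((toTop Obj.top 1 1 n).1 ≫ (toTop Obj.top 1 1 m).1)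
    rw [dg_comp, toTop_val, toTop_val, dg_tr, dg_tr, mul_comm]))

/-- `top` is Frobenius-trivial. [cite: MochizukiFrdI2008, Def. 1.2(iv) p.22] -/
theorem isFrobeniusTrivial_top : IsFrobeniusTrivial toElem Obj.top :=
  ⟨frobTop, fun n => ⟨rfl, rfl, isFrobeniusType_toTop 1 n (Or.inl rfl)⟩⟩

/-- `top` is isotropic. [cite: MochizukiFrdI2008, Def. 1.2(iv) p.23] -/
theorem isIsotropic_top : IsIsotropic toElem Obj.top := by
  intro B ψ hi hp
  cases B
  · exact (no_top_low ψ).elim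
  · exact (isIso_iff ψ).mpr ⟨rfl, hp.1, hi⟩

/-- `low` is NOT isotropic (`h₁` is a non-invertible isometric pre-step). [cite: MochizukiFrdI2008, Def. 1.2(iv) p.23] -/
theorem not_isIsotropic_low : ¬ IsIsotropic toElem Obj.low := fun h =>
  not_isIso_low_top _ (h (hHom 1) (hHom_isIsometry_isPreStep 1).1 (hHom_isIsometry_isPreStep 1).2)

/-- Isotropic objects are `top`. [cite: MochizukiFrdI2008, Def. 1.2(iv) p.23] -/
theorem eq_top_of_isIsotropic {A : Obj} (h : IsIsotropic toElem A) : A = Obj.top := by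
  cases A
  · exact (not_isIsotropic_low h).elim
  · rfl

/-- `h₁ : low → top` is an isotropic hull of `low`. [cite: MochizukiFrdI2008, Def. 1.2(iv) p.23] -/
theorem isIsotropicHull_hHom : IsIsotropicHull toElem (hHom 1) := by
  refine ⟨(hHom_isIsometry_isPreStep 1).1, (hHom_isIsometry_isPreStep 1).2, isIsotropic_top, ?_⟩
  intro C' γ hC'
  cases eq_top_of_isIsotropic hC'
  refine ⟨toTop Obj.top (bs γ.1) (dv γ.1) (dg γ.1), hom_ext (E_ext ?_ ?_ ?_), fun β hβ => ?_⟩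
  · simp [hHom]
  · simp [hHom]
  · simp [hHom]
  · rw [eq_toTop β]
    have h := congrArg Subtype.val hβ
    simp only [comp_val, hHom, toTop_val] at h
    refine hom_ext (E_ext ?_ ?_ ?_)
    · have := congrArg bs h; simp at this; simp [this]
    · have := congrArg dv h; simp at this; simp [this]
    · have := congrArg dg h; simp at this; simp [this]

/-- `low` is metrically trivial: its co-angular pre-steps are endomorphisms. [cite: MochizukiFrdI2008, Def. 1.2(iv) p.22] -/
theorem isMetricallyTrivial_low : IsMetricallyTrivial toElem Obj.low := by
  intro B ψ hc hp
  cases B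
  · exact ⟨Iso.refl _⟩
  · exact (not_isCoAngular_low_top hp.1 hc).elim

/-- `low` is NOT `Aut`-ample: no automorphism of `low` lies over `σ`. [cite: MochizukiFrdI2008, Def. 1.2(iv) p.23] -/
theorem not_isAutAmple_low : ¬ IsAutAmple toElem Obj.low := by
  intro h
  let i : (PreFrobenioid.baseFunctor toElem).obj Obj.low ≅ (PreFrobenioid.baseFunctor toElem).obj Obj.low :=
    ⟨σ, σ, show σ * σ = (1 : X) by decide, show σ * σ = (1 : X) by decide⟩
  obtain ⟨α, hα⟩ := h i
  have h1 : bs α.hom.1 = σ := congrArg Iso.hom hα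
  rw [bs_eq_one_of_isIso_low α.hom] at h1
  exact σ_ne_one h1.symm

end TwoLevel

end Literature.AlgebraicGeometry.Frobenioids
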